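import Summits.QuantumAdvantage.QuantumAdvantage.Theorems.CubicForrelationNearExactIsExactTwelveLevelSixSigmaSupp
import Summits.QuantumAdvantage.QuantumAdvantage.Theorems.CubicForrelationNearExactIsExactTwelveT1Engine
import Summits.QuantumAdvantage.QuantumAdvantage.Theorems.CubicForrelationNearExactIsExactTwelveWindow932TypeO

/-!
# Crux `CubicForrelation.NearExactIsExact` (stmt-QuantumAdvantage-14043) — n = 12: the (type O, base 960) × (level ≥ 6) configuration ("T1") is
  DEAD, hence NO cubic pair has `932/1024 ≤ Φ < 59/64` and `θ₁₂ ≤ 931/1024`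

Certificate seat `b2b-cforr-cert` (gen 18).  HONEST FRAMING: kernel-checked finite-slice theorems (standard axioms) about cubic Boolean pairs on
12 bits; a DECIDABLE-VERDICT step on the ladder (`932/1024` is not attained), NOT summit progress.  Classification-free: Kasami–Tokura's normal form
for weight-960 cubics is NOT used.

THEOREM `tw19_T1_false`: cubic `f, g` with `f` type O (`W_f = 16u`, some `u` odd) of base set `#E = 960`, `W_g = 64u''` and `Φ(f,g) ≥ 932/1024` do
not exist.  Proof.  The partner identity (`to18_typeO_E960_partner` for `(g, f)`): `64(u'' − (−1)^f)(x) = s_b(Ê(c₁⊕x) − 1024[x = c₁])`,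
`Ê(z) = Σ_{y∈E}(−1)^{y·z}`; budget `Σ e² = 736` (`e = u'' − (−1)^f`, `Φ = 932/1024` by zero excess).  Level-6 theory of `g`: `Z = {u'' even}` is
a 9-flat through `c₁`, `Z = c₁ ⊕ V₀`; off-`Z` energy `≤ 224`, so the off-flat trichotomy `tw18_off_flat_le224` and, in each branch, (H3)/(H4)
(`tw6_H34_tol` / `tw15_H34_avoid` / `tw18_H34_rigid_w2`); then `tw19_levelSix_sigma_supp`: `e ≡ σ (mod 4)` on `Z` and the transform of `σ·1_Z` is
supported on `≤ 32` points.  Re-based at `c₁`: `σ'(z) = σ(c₁⊕z)` on the SUBSPACE `V₀`, `t(z) = s_b·Ê(z)/64 ≡ σ'(z) (mod 4)`, `t(0) = 15 s_b`,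
`Σ_{V₀} t² ≤ Σ Ê²/4096 = 960`, and `s_b·Σ_{z∈V₀} t(z)(−1)^{z·x} = 8·#{y ∈ E : y ⊕ x ∈ V₀^⊥} ∈ [0, 64]` (Poisson, `#V₀^⊥ = 8`) — exactly the
hypotheses of the counting engine `t1e_engine`, which derives a contradiction from Parseval.
COROLLARIES: `tw19_window_932_false` (no cubic pair on 12 bits with `932/1024 ≤ Φ < 59/64`, by `tw19_window_932_typeO`), `tw19_isolation_ge_932`
(`Φ ≥ 932/1024 ⇒ Φ = 1`), `isolation_twelve_ge_932`, `theta_twelve_le_931` (`θ₁₂ ∈ [57/64, 931/1024]`).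

References: J. Ax (1964) / R. J. McEliece (1972); MacWilliams–Sloane (1977) Ch. 13–15; R. O'Donnell (2014) §3.3; C. Carlet (2021) §5.2.  Everything
below is proved from Mathlib and the tree; axioms are the standard three.
-/

set_option linter.dupNamespace false -- D-0017: single-problem summit ⇒ `QuantumAdvantage.QuantumAdvantage` by design

noncomputable section

namespace Summit.QuantumAdvantage.QuantumAdvantage.Theorems.CubicForrelation.NearExactIsExact

open Finset
open Literature.Computability.QuantumComplexity
open Literature.Computability.QuantumComplexity.BuzetChailloux (bxor zeroVec bxor_bxor_cancel_left bxor_zeroVec zeroVec_bxor bxor_comm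
  bxor_self twist_zeroVec_right twist_bxor_right)
open Literature.Computability.QuantumComplexity.DerivativeWalsh (W sum_W_sq twist_bxor_left card_mul_card_perp sum_twist_subspace)

/-- **No T1 pair**: cubic `f, g` on 12 bits with `f` type O of base set `960`, `W_g ∈ 64ℤ` and `Φ(f,g) ≥ 932/1024` do not exist (see the module
docstring).  Finite-slice statement, NOT summit progress. [this work] -/
theorem tw19_T1_false (f g : (Fin (6 + 6) → Bool) → Bool) (hf : IsDegLeFun 3 f) (hg : IsDegLeFun 3 g)
    (uO : (Fin (6 + 6) → Bool) → ℤ) (huO : ∀ y, W (fun x => signOf (f x)) y = (2 : ℝ) ^ 4 * (uO y : ℝ)) (hoddO : ∃ y, Odd (uO y))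
    (hE : #(univ.filter fun y : Fin (6 + 6) → Bool => (Odd (uO y / 2) ↔ Odd (uO y / 2 / 2))) = 960)
    (u'' : (Fin (6 + 6) → Bool) → ℤ) (hu'' : ∀ x, W (fun y => signOf (g y)) x = (2 : ℝ) ^ 6 * (u'' x : ℝ))
    (hΦ : (932 / 1024 : ℝ) ≤ forrelation f g) : False := by
  classical
  have hΦ' : forrelation g f = forrelation f g := by
    rw [Summit.QuantumAdvantage.QuantumAdvantage.Theorems.SignedCubicForrelationNotPrBPP.Negative.HalfQuad.forrelation_comm]
  have hlo' : (932 / 1024 : ℝ) ≤ forrelation g f := by rw [hΦ']; exact hΦ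
  set E := univ.filter (fun y : Fin (6 + 6) → Bool => (Odd (uO y / 2) ↔ Odd (uO y / 2 / 2))) with hEdef
  -- level-4 data of `g`, the partner identity, `Φ = 932/1024`
  set u : (Fin (6 + 6) → Bool) → ℤ := fun x => 4 * u'' x with hudef
  have hu : ∀ x, W (fun y => signOf (g y)) x = (2 : ℝ) ^ 4 * (u x : ℝ) := by
    intro x; rw [hu'' x]; simp only [u]; push_cast; ring
  obtain ⟨c₁, b₁, -, hid, -⟩ := to18_typeO_E960_partner g f hf uO huO hoddO hE hlo' u hu
  have hΦeq : forrelation f g = 932 / 1024 := by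
    rw [← hΦ']; exact (to18_typeO_E960_zero_excess g f hf uO huO hoddO hE hlo').2
  -- the residual and its explicit form `64 e(x) = s_b (Ê(c₁ ⊕ x) − 1024 [x = c₁])`
  set e : (Fin (6 + 6) → Bool) → ℤ := fun x => u'' x - sZ (f x) with hedef
  set Eh : (Fin (6 + 6) → Bool) → ℝ := fun z => ∑ y ∈ E, twist y z with hEh
  have hsb : ((sZ b₁ : ℤ) : ℝ) = signOf b₁ := tp_sZ_cast _
  have hsb1 : signOf b₁ * signOf b₁ = (1 : ℝ) := by cases b₁ <;> simp [signOf]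
  have hexp : ∀ x, 64 * (e x : ℝ) = signOf b₁ * (Eh (bxor c₁ x) - (if bxor c₁ x = (fun _ => false) then 1024 else 0)) := by
    intro x
    have h := hid x
    have he' : ((e x : ℤ) : ℝ) = (u'' x : ℝ) - signOf (f x) := by simp only [hedef]; push_cast; rw [tp_sZ_cast]
    have hEh' : Eh (bxor c₁ x) =
        ∑ y ∈ univ.filter (fun y : Fin (6 + 6) → Bool => (Odd (uO y / 2) ↔ Odd (uO y / 2 / 2))), twist y (bxor c₁ x) := rfl
    rw [he', hEh']
    simp only [u] at h
    push_cast at h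
    split_ifs at h ⊢ <;> linear_combination h / 4
  have hEcard : #E = 960 := hE
  have hEh0 : Eh (fun _ => false) = 960 := by
    show ∑ y ∈ E, twist y zeroVec = 960
    rw [sum_congr rfl fun y _ => twist_zeroVec_right y, sum_const, hEcard]; norm_num
  have hec₁ : (e c₁ : ℝ) = -signOf b₁ := by
    have h := hexp c₁
    rw [show bxor c₁ c₁ = (fun _ => false) from bxor_self c₁, if_pos rfl, hEh0] at h
    linarith
  -- budget `Σ e² = 736`
  have hbud := tw12_budget f g u hu
  have h16 : ∀ x, (u x - 4 * sZ (f x)) ^ 2 = 16 * e x ^ 2 := fun x => by simp only [u, e]; ring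
  have hBR : ((∑ x, e x ^ 2 : ℤ) : ℝ) = 8192 * (1 - forrelation f g) := by
    have h' : ((∑ x, (u x - 4 * sZ (f x)) ^ 2 : ℤ) : ℝ) = 16 * ((∑ x, e x ^ 2 : ℤ) : ℝ) := by
      rw [sum_congr rfl fun x _ => h16 x, ← mul_sum]; push_cast; ring
    rw [h'] at hbud
    linarith
  have hB_le : (∑ x, e x ^ 2 : ℤ) ≤ 736 := by
    have h' : ((∑ x, e x ^ 2 : ℤ) : ℝ) ≤ 736 := by rw [hBR, hΦeq]; norm_num
    exact_mod_cast h'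
  -- the even set `Z` of `u''`: odd residual, `#Z = 512`, a 9-flat through `c₁`
  set Z := univ.filter (fun x : Fin (6 + 6) → Bool => ¬ Odd (u'' x)) with hZdef
  have hmemZ : ∀ x, x ∈ Z ↔ ¬ Odd (u'' x) := fun x => by simp [hZdef]
  have heodd : ∀ x, x ∈ Z → Odd (e x) := by
    intro x hx
    have hev := Int.not_odd_iff_even.1 ((hmemZ x).1 hx)
    rcases tp_sZ_cases (f x) with hs | hs <;> simp only [e] <;> rw [hs]
    · exact Int.odd_sub.2 (iff_of_false (Int.not_odd_iff_even.2 hev) (by decide))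
    · exact Int.odd_sub.2 (iff_of_false (Int.not_odd_iff_even.2 hev) (by decide))
  have hsq1 : ∀ x, x ∈ Z → 1 ≤ e x ^ 2 := by
    intro x hx
    have h0 := Int.odd_iff.1 (heodd x hx)
    have : e x ≤ -1 ∨ 1 ≤ e x := by omega
    have := tp_sq_ge (k := 1) (by norm_num) this
    linarith
  have hsplit : (∑ x, e x ^ 2 : ℤ) = ∑ x ∈ Z, e x ^ 2 + ∑ x ∈ univ.filter (fun x => x ∉ Z), e x ^ 2 := by
    rw [← sum_filter_add_sum_filter_not univ (fun x => x ∈ Z)]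
    congr 1
    exact sum_congr (by ext x; simp) fun _ _ => rfl
  have hZle : (#Z : ℤ) ≤ 736 := by
    have h2 : ∑ x ∈ Z, (1 : ℤ) ≤ ∑ x ∈ Z, e x ^ 2 := sum_le_sum fun x hx => hsq1 x hx
    rw [sum_const, nsmul_eq_mul, mul_one] at h2
    linarith [sum_nonneg fun x (_ : x ∈ univ.filter (fun x => x ∉ Z)) => sq_nonneg (e x)]
  have hpar : ∑ x, u'' x ^ 2 = 4096 := by
    have h := zms_sum_u_sq 2 g u (fun x => (hu x).trans (by norm_num))
    have e' : ∑ x, ((u x : ℝ)) ^ 2 = 16 * ∑ x, ((u'' x : ℝ)) ^ 2 := by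
      rw [mul_sum]; exact sum_congr rfl fun x _ => by simp only [u]; push_cast; ring
    rw [e'] at h
    norm_num at h
    have h' : ∑ x, ((u'' x : ℝ)) ^ 2 = 4096 := by linarith
    exact_mod_cast h'
  by_cases hall : ∀ x, Odd (u'' x)
  · have hsq1' : ∀ x, u'' x ^ 2 = 1 := by
      have hge : ∀ x, (1 : ℤ) ≤ u'' x ^ 2 := fun x => by
        have h0 := Int.odd_iff.1 (hall x)
        have : u'' x ≤ -1 ∨ 1 ≤ u'' x := by omega
        have := tp_sq_ge (k := 1) (by norm_num) this
        linarith
      have hsum0 : ∑ x, (u'' x ^ 2 - 1 : ℤ) = 0 := by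
        rw [sum_sub_distrib, hpar, sum_const, card_univ, Fintype.card_fun, Fintype.card_bool, Fintype.card_fin]; norm_num
      intro x
      have := (sum_eq_zero_iff_of_nonneg fun y _ => by have := hge y; linarith).1 hsum0 x (mem_univ x)
      linarith
    have hbent : ∀ x, W (fun y => signOf (g y)) x ^ 2 = (2 : ℝ) ^ (6 + 6) := by
      intro x
      rw [hu'' x, mul_pow]
      have : ((u'' x : ℝ)) ^ 2 = 1 := by exact_mod_cast hsq1' x
      rw [this]; norm_num
    rcases tw_bent_end (by norm_num) f g hf hg hbent with h | h
    · rw [h] at hΦeq; norm_num at hΦeq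
    · rw [hΦeq] at h; norm_num at h
  push Not at hall
  obtain ⟨x₁, hx₁⟩ := hall
  have hp : IsDegLeFun 3 (fun x => decide (Odd (u'' x))) :=
    stub_walshTower stub_axParity (6 + 6) 6 3 g u'' hg hu'' (by intro k hk hkn; omega)
  have hp' : IsDegLeFun (2 + 1) (fun x => decide (Odd (u'' x)) ^^ true) := tb_isDegLeFun_xor_const hp true
  have hfilt : (univ.filter fun x : Fin (6 + 6) → Bool => (decide (Odd (u'' x)) ^^ true) = true) = Z :=
    filter_congr fun x _ => by simp
  have hne : ∃ x, (decide (Odd (u'' x)) ^^ true) = true := ⟨x₁, by simpa using hx₁⟩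
  have hRM := bb_rmWeight_holds (6 + 6) 3 (fun x => decide (Odd (u'' x)) ^^ true) hp' hne
  rw [hfilt] at hRM
  have hZge : 512 ≤ #Z := by norm_num at hRM; omega
  have hZcard : #Z = 512 := by
    have hZle' : #Z ≤ 736 := by exact_mod_cast hZle
    have hsw := sw_cubic_second_weight (m := 6 + 6) _ hp' hne (by rw [hfilt]; norm_num; omega)
    rw [hfilt] at hsw
    norm_num at hsw
    omega
  have hmw := mw_flat_of_minweight 2 (fun x => decide (Odd (u'' x)) ^^ true) hp' (by rw [hfilt, hZcard]; norm_num)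
  rw [hfilt] at hmw
  obtain ⟨h0, hadd, hcardV, hcoset⟩ := hmw
  set V₀ := univ.filter (fun a : Fin (6 + 6) → Bool => ∀ x,
    (decide (Odd (u'' (bxor x a))) ^^ true) = (decide (Odd (u'' x)) ^^ true)) with hV₀
  rw [hZcard] at hcardV
  have hcardV9 : #V₀ = 2 ^ 9 := by rw [hcardV]; norm_num
  -- `c₁ ∈ Z` (there `e = −s_b` is odd), so `Z = c₁ ⊕ V₀`
  have hec₁Z : e c₁ = -sZ b₁ := by
    have h : (e c₁ : ℝ) = ((-sZ b₁ : ℤ) : ℝ) := by push_cast; rw [hsb]; exact hec₁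
    exact_mod_cast h
  have hc₁Z : c₁ ∈ Z := by
    rw [hmemZ]
    intro hodd
    have hu1 : u'' c₁ = sZ (f c₁) + e c₁ := by simp only [e]; ring
    rw [hu1, hec₁Z] at hodd
    rcases tp_sZ_cases (f c₁) with h1 | h1 <;> rcases tp_sZ_cases b₁ with h2 | h2 <;> rw [h1, h2] at hodd <;>
      exact absurd hodd (by decide)
  have hS : Z = V₀.image (bxor c₁) := hcoset c₁ (by have h := (hmemZ c₁).1 hc₁Z; simpa using h)
  have hZsum_ge : (512 : ℤ) ≤ ∑ x ∈ Z, e x ^ 2 := by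
    have h1 : ∑ x ∈ Z, (1 : ℤ) ≤ ∑ x ∈ Z, e x ^ 2 := sum_le_sum fun x hx => hsq1 x hx
    rw [sum_const, nsmul_eq_mul, mul_one, hZcard] at h1
    exact_mod_cast h1
  have hoff_le : ∑ x ∈ univ.filter (fun x => x ∉ Z), e x ^ 2 ≤ 224 := by linarith
  -- (H3)/(H4) in every branch of the off-flat trichotomy
  have hH34 : (∀ x ∈ Z, ∀ a b c : Fin (6 + 6) → Bool, a ∈ V₀ → b ∈ V₀ → c ∈ V₀ →
      (4 : ℤ) ∣ ∑ ε : Fin 3 → Bool, e (fun j => x j ^^ decide (Odd #(univ.filter fun i =>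
        ε i && (![a, b, c] : Fin 3 → Fin (6 + 6) → Bool) i j)))) ∧
    (∀ x ∈ Z, ∀ a₀ a₁ a₂ a₃ : Fin (6 + 6) → Bool, a₀ ∈ V₀ → a₁ ∈ V₀ → a₂ ∈ V₀ → a₃ ∈ V₀ →
      (8 : ℤ) ∣ ∑ ε : Fin 4 → Bool, e (fun j => x j ^^ decide (Odd #(univ.filter fun i =>
        ε i && (![a₀, a₁, a₂, a₃] : Fin 4 → Fin (6 + 6) → Bool) i j)))) := by
    rcases tw18_off_flat_le224 f g hf hg u'' hu'' V₀ c₁ h0 hadd hcardV9 hS hoff_le with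
        h8 | ⟨y₁, y₂, hy₁, hy₂, hy₁₂, hoff, hk₁, hk₂, -⟩ |
        ⟨y₁, y₂, y₃, hy₁, hy₂, hy₃, hy₁₂, hy₁₃, hy₂₃, hΩC, hΩ56, ⟨ω₄, ω₄', hΩsq⟩, -⟩
    · exact tw6_H34_tol f g hf hg u'' hu'' V₀ c₁ h0 hadd hcardV hS h8
    · exact tw15_H34_avoid f g hf hg u'' hu'' V₀ c₁ h0 hadd hcardV hS y₁ y₂ hy₁ hy₂ hy₁₂ hoff hk₁ hk₂
    · exact tw18_H34_rigid_w2 f g hf hg u'' hu'' V₀ c₁ h0 hadd hcardV hS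
        (univ.filter fun ω => ω ∉ Z ∧ ¬ (8 : ℤ) ∣ e ω) y₁ y₂ y₃ hy₁ hy₂ hy₃ hy₁₂ hy₁₃ hy₂₃ hΩC (hΩ56.trans (by norm_num))
        (fun y hy h8 => mem_filter.2 ⟨mem_univ _, hy, h8⟩) ω₄ ω₄' hΩsq
  obtain ⟨H3, H4⟩ := hH34
  obtain ⟨hmod4, -, hsuppZ⟩ := tw19_levelSix_sigma_supp 736 (by norm_num) f g u'' hu'' hB_le V₀ c₁ h0 hadd hcardV hS H3 H4
  set hb : (Fin (6 + 6) → Bool) → Bool := fun x => decide (e x % 4 = 3) with hhb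
  have hmod4' : ∀ x ∈ Z, (4 : ℤ) ∣ e x - sZ (hb x) := hmod4
  have hsuppZ' : #(univ.filter fun y : Fin (6 + 6) → Bool =>
      W (fun x => if x ∈ Z then ((sZ (hb x) : ℤ) : ℝ) else 0) y ≠ 0) * 512 ≤ 4 * 2 ^ (6 + 6) := hsuppZ
  -- re-base at `c₁`: the pattern `σ'` on the subspace `V₀`
  set σ : (Fin (6 + 6) → Bool) → ℤ := fun z => sZ (hb (bxor c₁ z)) with hσdef
  have hWtr : ∀ x, W (fun y => if y ∈ Z then ((sZ (hb y) : ℤ) : ℝ) else 0) x =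
      twist c₁ x * W (fun z => if z ∈ V₀ then (σ z : ℝ) else 0) x := by
    intro x
    unfold W
    have lhs : ∑ y, (if y ∈ Z then ((sZ (hb y) : ℤ) : ℝ) else 0) * twist y x = ∑ y ∈ Z, ((sZ (hb y) : ℤ) : ℝ) * twist y x := by
      rw [sum_congr rfl fun y _ => by rw [ite_mul, zero_mul], sum_ite_mem, univ_inter]
    have rhs : ∑ z, (if z ∈ V₀ then (σ z : ℝ) else 0) * twist z x = ∑ z ∈ V₀, (σ z : ℝ) * twist z x := by
      rw [sum_congr rfl fun z _ => by rw [ite_mul, zero_mul], sum_ite_mem, univ_inter]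
    rw [lhs, rhs, hS, sum_image fun a _ b _ h => by simpa only [bxor_bxor_cancel_left] using congrArg (bxor c₁) h, mul_sum]
    refine sum_congr rfl fun z _ => ?_
    simp only [σ]; rw [twist_bxor_left]; ring
  have hsuppV : #(univ.filter fun x : Fin (6 + 6) → Bool => W (fun z => if z ∈ V₀ then (σ z : ℝ) else 0) x ≠ 0) ≤ 32 := by
    have e1 : (univ.filter fun x : Fin (6 + 6) → Bool => W (fun z => if z ∈ V₀ then (σ z : ℝ) else 0) x ≠ 0) =
        univ.filter fun y : Fin (6 + 6) → Bool => W (fun x => if x ∈ Z then ((sZ (hb x) : ℤ) : ℝ) else 0) y ≠ 0 := by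
      refine filter_congr fun x _ => ?_
      rw [hWtr x]
      have htw : twist c₁ x ≠ 0 := by
        intro h0'; have := abs_twist c₁ x; rw [h0', abs_zero] at this; norm_num at this
      rw [mul_ne_zero_iff]
      exact ⟨fun h => ⟨htw, h⟩, fun h => h.2⟩
    rw [e1]
    omega
  -- the integer lift `t = s_b Ê/64` on `V₀`
  have hσpm : ∀ z ∈ V₀, σ z = 1 ∨ σ z = -1 := fun z _ => tp_sZ_cases _
  set t : (Fin (6 + 6) → Bool) → ℤ := fun z => e (bxor c₁ z) + (if z = (fun _ => false) then 16 * sZ b₁ else 0) with htdef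
  have hmemV : ∀ z ∈ V₀, bxor c₁ z ∈ Z := fun z hz => by rw [hS]; exact mem_image.2 ⟨z, hz, rfl⟩
  have hmod : ∀ z ∈ V₀, (4 : ℤ) ∣ t z - σ z := by
    intro z hz
    obtain ⟨k, hk⟩ := hmod4' (bxor c₁ z) (hmemV z hz)
    simp only [t, σ]
    split_ifs
    · exact ⟨k + 4 * sZ b₁, by linarith⟩
    · exact ⟨k, by linarith⟩
  have ht0 : t zeroVec = 15 * sZ b₁ := by
    simp only [t]
    rw [if_pos (show (zeroVec : Fin (6 + 6) → Bool) = (fun _ => false) from rfl), show bxor c₁ zeroVec = c₁ from bxor_zeroVec c₁,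
      hec₁Z]; ring
  have htE : ∀ z, (t z : ℝ) = signOf b₁ * Eh z / 64 := by
    intro z
    have h := hexp (bxor c₁ z)
    rw [bxor_bxor_cancel_left] at h
    simp only [t]; push_cast; rw [tp_sZ_cast]
    split_ifs at h ⊢ <;> linarith
  have henergy : ∑ z ∈ V₀, t z ^ 2 ≤ 960 := by
    have hP : ∑ z, Eh z ^ 2 = 4096 * 960 := by
      have h := sum_W_sq (fun y => if y ∈ E then (1 : ℝ) else 0)
      have eW : ∀ z, W (fun y => if y ∈ E then (1 : ℝ) else 0) z = Eh z := by
        intro z; unfold W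
        rw [sum_congr rfl fun y _ => by rw [ite_mul, zero_mul, one_mul], sum_ite_mem, univ_inter]
      have esq : ∀ y, (if y ∈ E then (1 : ℝ) else 0) ^ 2 = if y ∈ E then (1 : ℝ) else 0 := fun y => by split_ifs <;> norm_num
      rw [sum_congr rfl fun z _ => by rw [eW z], sum_congr rfl fun y _ => esq y, sum_ite_mem, univ_inter, sum_const, hEcard] at h
      rw [h]; norm_num
    have h1 : ∑ z ∈ V₀, ((t z : ℤ) : ℝ) ^ 2 ≤ ∑ z, ((t z : ℤ) : ℝ) ^ 2 :=
      sum_le_sum_of_subset_of_nonneg (subset_univ _) (fun _ _ _ => sq_nonneg _)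
    have h2 : ∑ z, ((t z : ℤ) : ℝ) ^ 2 = 960 := by
      rw [sum_congr rfl fun z _ => by rw [htE z]]
      have e2 : ∀ z, (signOf b₁ * Eh z / 64) ^ 2 = Eh z ^ 2 / 4096 := fun z => by
        rw [div_pow, mul_pow, sq, hsb1]; ring
      rw [sum_congr rfl fun z _ => e2 z, ← sum_div, hP]; norm_num
    have h3 : ((∑ z ∈ V₀, t z ^ 2 : ℤ) : ℝ) ≤ 960 := by push_cast; linarith
    exact_mod_cast h3
  -- `s_b Σ_{V₀} t χ_x = 8 · #{y ∈ E : y ⊕ x ∈ V₀^⊥} ∈ [0, 64]`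
  have hsum : ∀ x, ((sZ b₁ : ℤ) : ℝ) * ∑ z ∈ V₀, (t z : ℝ) * twist z x =
      8 * #(E.filter fun y => ∀ z ∈ V₀, twist z (bxor y x) = 1) := by
    intro x
    rw [hsb, mul_sum, sum_congr rfl fun z _ => by rw [htE z]]
    have e1 : ∀ z, signOf b₁ * (signOf b₁ * Eh z / 64 * twist z x) = (Eh z * twist z x) / 64 := fun z => by
      calc signOf b₁ * (signOf b₁ * Eh z / 64 * twist z x) = (signOf b₁ * signOf b₁) * (Eh z * twist z x) / 64 := by ring
        _ = (Eh z * twist z x) / 64 := by rw [hsb1, one_mul]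
    rw [sum_congr rfl fun z _ => e1 z, ← sum_div]
    have e2 : ∑ z ∈ V₀, Eh z * twist z x = ∑ y ∈ E, ∑ z ∈ V₀, twist z (bxor y x) := by
      simp only [Eh]
      rw [sum_congr rfl fun z _ => by rw [sum_mul], sum_comm]
      exact sum_congr rfl fun y _ => sum_congr rfl fun z _ => by rw [twist_comm y z, ← twist_bxor_right]
    rw [e2, sum_congr rfl fun y _ => sum_twist_subspace hadd (bxor y x), ← sum_filter, sum_const, hcardV, nsmul_eq_mul]
    push_cast
    ring
  have hperp8 : (#(univ.filter fun w : Fin (6 + 6) → Bool => ∀ z ∈ V₀, twist z w = 1) : ℝ) = 8 := by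
    have h := card_mul_card_perp h0 hadd
    rw [hcardV] at h
    norm_num at h
    linarith
  have hcount : ∀ x, (#(E.filter fun y => ∀ z ∈ V₀, twist z (bxor y x) = 1) : ℝ) ≤ 8 := by
    intro x
    rw [← hperp8]
    exact_mod_cast card_le_card_of_injOn (fun y => bxor y x) (fun y hy => by
        rw [mem_coe, mem_filter] at hy ⊢; exact ⟨mem_univ _, hy.2⟩)
      (fun y _ y' _ h => by
        have h' : bxor x y = bxor x y' := by rw [bxor_comm x y, bxor_comm x y']; exact h
        simpa only [bxor_bxor_cancel_left] using congrArg (bxor x) h')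
  have hpos : ∀ x, 0 ≤ ((sZ b₁ : ℤ) : ℝ) * ∑ z ∈ V₀, (t z : ℝ) * twist z x := fun x => by rw [hsum x]; positivity
  have hle64 : ∀ x, ((sZ b₁ : ℤ) : ℝ) * ∑ z ∈ V₀, (t z : ℝ) * twist z x ≤ 64 := fun x => by
    rw [hsum x]; linarith [hcount x]
  exact t1e_engine V₀ h0 hcardV σ hσpm hsuppV (sZ b₁) (tp_sZ_cases b₁) t hmod ht0 henergy hpos hle64

/-! ### Corollaries: the window is empty, `θ₁₂ ≤ 931/1024` -/

/-- **No cubic pair on 12 bits has `932/1024 ≤ Φ < 59/64`.** [this work] -/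
theorem tw19_window_932_false (f g : (Fin (6 + 6) → Bool) → Bool) (hf : IsDegLeFun 3 f) (hg : IsDegLeFun 3 g)
    (hlo : (932 / 1024 : ℝ) ≤ forrelation f g) (hhi : forrelation f g < 59 / 64) : False := by
  have hΦ' : forrelation g f = forrelation f g := by
    rw [Summit.QuantumAdvantage.QuantumAdvantage.Theorems.SignedCubicForrelationNotPrBPP.Negative.HalfQuad.forrelation_comm]
  rcases tw19_window_932_typeO f g hf hg hlo hhi with ⟨u, hu, hodd, hE, w, hw⟩ | ⟨u, hu, hodd, hE, w, hw⟩
  · exact tw19_T1_false g f hg hf u hu hodd hE w hw (by rw [hΦ']; exact hlo)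
  · exact tw19_T1_false f g hf hg u hu hodd hE w hw hlo

/-- **Isolation at `932/1024` on 12 bits**: `Φ(f,g) ≥ 932/1024 ⇒ Φ(f,g) = 1` for cubic `f, g`. [this work] -/
theorem tw19_isolation_ge_932 (f g : (Fin (6 + 6) → Bool) → Bool) (hf : IsDegLeFun 3 f) (hg : IsDegLeFun 3 g)
    (hΦ : (932 / 1024 : ℝ) ≤ forrelation f g) : forrelation f g = 1 := by
  by_cases hhi : forrelation f g < 59 / 64
  · exact (tw19_window_932_false f g hf hg hΦ hhi).elim
  · exact tw18_isolation_gt_932 f g hf hg (by push Not at hhi; linarith)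

/-- **Packaging at `Fin 12`**: `Φ ≥ 932/1024 ⇒ Φ = 1` for cubic pairs on 12 bits, i.e. `θ₁₂ ≤ 931/1024` (with `theta_twelve_ge`: `θ₁₂ ∈ [57/64, 931/1024]`).
A decidable-verdict step on the finite ladder; NOT summit progress. [this work] -/
theorem isolation_twelve_ge_932 : ∀ f g : (Fin 12 → Bool) → Bool, IsDegLeFun 3 f → IsDegLeFun 3 g →
    (932 / 1024 : ℝ) ≤ forrelation f g → forrelation f g = 1 :=
  fun f g hf hg hΦ => tw19_isolation_ge_932 f g hf hg hΦ

end Summit.QuantumAdvantage.QuantumAdvantage.Theorems.CubicForrelation.NearExactIsExact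

end
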